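import Mathlib.CategoryTheory.Limits.Preserves.Shapes.BinaryProducts
import Literature.AnabelianGeometry.Anabelioids.ComponentPieces
import Literature.AnabelianGeometry.SemiGraphs.SectionPullbackInvisible

/-!
# The doubled object `A ⊔ A`, the component swap, and the sections of its invisible regluings
# ([SemiAnbd] §2, Def. 2.2 (i) p. 23, Cor. 2.7 (i) p. 30)

Mochizuki, *Semi-graphs of anabelioids*, Publ. RIMS **42** (2006) 221–322, §2: Def. 2.2 (i) p. 23 (the
cells of the covering attached to `A` over `e` are the components of `T_e`), proof of Cor. 2.7 (i) p. 30
(two sheets `ℋ″`, `g·ℋ″`) [cite: MochizukiSemiAnbd2006, Cor. 2.7(i) p.30].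

abc-iut cell, layer L3, FACT-LIST row F-1487 (`covering_subgraphComponents_doubleCosets` AS TYPED), seat
abc-iut-w4-d080 — brick (R5a–d) «detection object» of the tree-free «regluing invisibility» route
(`HOME/staging/w4/w4-d080-g7/F1487-MASSBALANCE-MEMO.md` §5; GAP row G-w4d080-g7-1):

* `Anabelioids.doubleOver X = (X ⊔ X → X)`, `Anabelioids.swapOver`, `Anabelioids.componentSwap X Q` — in a
  connected anabelioid, the automorphism of `X ⊔ X` over `X` swapping the two sheets OVER ONE CONNECTED
  COMPONENT `Q ⊆ X` and fixing the others (abc-iut-L3-t5/t6's `Over.isoOfPieces`), with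
  `fst_comp_componentSwap_of_ne` (it is the identity on the piece over every `P ≠ Q`);
* `BObj.double A = A ⊔ A ∈ B(𝒢)` (cellwise, glued through the exact branch functors), `BObj.codiag`,
  `BObj.inl` (a section), `BObj.doubleTwist A b₀ Q` — the branch-indexed family of twists of `A ⊔ A` over
  `A` which is the component swap over `Q ⊆ A_{e(b₀)}` at `b₀` and the identity elsewhere;
* `Hom.exists_section_double_reglue` — **if the tautological section of the global clause AVOIDS the cell
  `Q` at every branch of `𝒢′` over `b₀`, then the reglued double `(A ⊔ A)^{θ_Q} → A` still has a section**
  (the engine `Hom.overIsoOfSupportedReglue`, abc-iut-w4-d080 (R3b)/(R4)).  The pending consumer (R5e):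
  for a NON-SEPARATING cell `(e(b₀), Q)` of `𝔾_A` the reglued double has no section — so such cells are
  never avoided, i.e. they are edge section labels (the CORE LEMMA of the memo, non-separating half).

Nothing here takes a side on [IUTchIII] Cor. 3.12.
-/

namespace Literature.AnabelianGeometry

open CategoryTheory CategoryTheory.Limits CategoryTheory.PreGaloisCategory

-- objects occur under several definitionally equal presentations; let unification see through them.
set_option backward.isDefEq.respectTransparency false

universe v₁ u₁ u

/-! ### The component swap in a connected anabelioid -/

namespace Anabelioids

variable {C : Type u₁} [Category.{v₁} C] [GaloisCategory C] (X : C)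

/-- The codiagonal `X ⊔ X → X` as an object over `X` (two trivial sheets).
[cite: MochizukiSemiAnbd2006, Cor. 2.7(i) p.30] -/
noncomputable abbrev doubleOver : Over X := Over.mk (coprod.desc (𝟙 X) (𝟙 X))

/-- The swap of the two sheets of `X ⊔ X`, over `X`. [cite: MochizukiSemiAnbd2006, Cor. 2.7(i) p.30] -/
noncomputable def swapOver : doubleOver X ≅ doubleOver X :=
  Over.isoMk (coprod.braiding X X) (by
    change coprod.desc coprod.inr coprod.inl ≫ coprod.desc (𝟙 X) (𝟙 X) = coprod.desc (𝟙 X) (𝟙 X)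
    ext
    · simp only [coprod.inl_desc_assoc, coprod.inr_desc, coprod.inl_desc]
    · simp only [coprod.inr_desc_assoc, coprod.inl_desc, coprod.inr_desc])

open scoped Classical in
/-- **The component swap**: the automorphism of `X ⊔ X` (over `X`) which swaps the two sheets over the
connected component `Q ⊆ X` and is the identity over every other component — assembled piece by piece
over the components of `X` (`Over.isoOfPieces`). [cite: MochizukiSemiAnbd2006, Cor. 2.7(i) p.30] -/
noncomputable def componentSwap (Q : {P : Subobject X // IsConnected (P : C)}) : X ⨿ X ≅ X ⨿ X :=
  haveI := finite_connectedSubobject X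
  (Over.forget X).mapIso
    (Over.isoOfPieces (Equiv.refl {P : Subobject X // IsConnected (P : C)})
      (Y := doubleOver X) (Y' := doubleOver X)
      (fun P => if P = Q then (Over.pullback P.1.arrow).mapIso (swapOver X) else Iso.refl _))

/-- The component swap lies over `X`. [cite: MochizukiSemiAnbd2006, Cor. 2.7(i) p.30] -/
theorem componentSwap_hom_comp_desc (Q : {P : Subobject X // IsConnected (P : C)}) :
    (componentSwap X Q).hom ≫ coprod.desc (𝟙 X) (𝟙 X) = coprod.desc (𝟙 X) (𝟙 X) := by
  classical
  haveI := finite_connectedSubobject X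
  exact Over.w (Over.isoOfPieces (Equiv.refl {P : Subobject X // IsConnected (P : C)})
      (Y := doubleOver X) (Y' := doubleOver X)
      (fun P => if P = Q then (Over.pullback P.1.arrow).mapIso (swapOver X) else Iso.refl _)).hom

/-- **The component swap is the identity over the other components**: on the piece of `X ⊔ X` over a
component `P ≠ Q` it restricts to the identity. [cite: MochizukiSemiAnbd2006, Cor. 2.7(i) p.30] -/
theorem fst_comp_componentSwap_of_ne (Q P : {P : Subobject X // IsConnected (P : C)}) (hPQ : P ≠ Q) :
    pullback.fst (coprod.desc (𝟙 X) (𝟙 X)) P.1.arrow ≫ (componentSwap X Q).hom =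
      pullback.fst (coprod.desc (𝟙 X) (𝟙 X)) P.1.arrow := by
  classical
  haveI := finite_connectedSubobject X
  have h := pullback_fst_isoOfPieces_hom_left (Equiv.refl {P : Subobject X // IsConnected (P : C)})
    (Y := doubleOver X) (Y' := doubleOver X)
    (fun P => if P = Q then (Over.pullback P.1.arrow).mapIso (swapOver X) else Iso.refl _) P
  rw [if_neg hPQ] at h
  exact h.trans (Category.id_comp _)

end Anabelioids

/-! ### The doubled object of `B(𝒢)` -/

namespace SemiGraphs

namespace SemiGraphOfAnabelioids

variable {𝒢' 𝒢 : SemiGraphOfAnabelioids.{v₁, u₁, u}}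

namespace BObj

variable (A : 𝒢.BObj)

/-- **`A ⊔ A ∈ B(𝒢)`**: two copies of `A`, cell by cell, glued through the exact branch functors
(`b^*(S_v ⊔ S_v) ≅ b^*S_v ⊔ b^*S_v ⥲ T_e ⊔ T_e`). [cite: MochizukiSemiAnbd2006, Def. 2.1 pp.22-23] -/
noncomputable def double : 𝒢.BObj where
  S v := A.S v ⨿ A.S v
  T e := A.T e ⨿ A.T e
  ψ b v h :=
    haveI : PreservesFiniteColimits (𝒢.pull b v h).pullback := (𝒢.pull b v h).property.2
    (PreservesColimitPair.iso (𝒢.pull b v h).pullback (A.S v) (A.S v)).symm ≪≫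
      coprod.mapIso (A.ψ b v h) (A.ψ b v h)

/-- The branch functor applied to the first coprojection, through the gluing of `A ⊔ A`.
[cite: MochizukiSemiAnbd2006, Def. 2.1 p.23] -/
theorem map_inl_comp_double_ψ_hom (b : 𝒢.graph.Branch) (v : 𝒢.graph.Vertex)
    (h : 𝒢.graph.abuts b = some v) :
    (𝒢.pull b v h).pullback.map coprod.inl ≫ (A.double.ψ b v h).hom = (A.ψ b v h).hom ≫ coprod.inl := by
  haveI : PreservesFiniteColimits (𝒢.pull b v h).pullback := (𝒢.pull b v h).property.2
  change (𝒢.pull b v h).pullback.map coprod.inl ≫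
      (PreservesColimitPair.iso (𝒢.pull b v h).pullback (A.S v) (A.S v)).inv ≫
        coprod.map (A.ψ b v h).hom (A.ψ b v h).hom = _
  rw [← coprodComparison_inl, ← PreservesColimitPair.iso_hom, Category.assoc,
    Iso.hom_inv_id_assoc, coprod.inl_map]

/-- The branch functor applied to the second coprojection, through the gluing of `A ⊔ A`.
[cite: MochizukiSemiAnbd2006, Def. 2.1 p.23] -/
theorem map_inr_comp_double_ψ_hom (b : 𝒢.graph.Branch) (v : 𝒢.graph.Vertex)
    (h : 𝒢.graph.abuts b = some v) :
    (𝒢.pull b v h).pullback.map coprod.inr ≫ (A.double.ψ b v h).hom = (A.ψ b v h).hom ≫ coprod.inr := by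
  haveI : PreservesFiniteColimits (𝒢.pull b v h).pullback := (𝒢.pull b v h).property.2
  change (𝒢.pull b v h).pullback.map coprod.inr ≫
      (PreservesColimitPair.iso (𝒢.pull b v h).pullback (A.S v) (A.S v)).inv ≫
        coprod.map (A.ψ b v h).hom (A.ψ b v h).hom = _
  rw [← coprodComparison_inr, ← PreservesColimitPair.iso_hom, Category.assoc,
    Iso.hom_inv_id_assoc, coprod.inr_map]

/-- The codiagonal `A ⊔ A → A`. [cite: MochizukiSemiAnbd2006, Def. 2.1 p.23] -/
noncomputable def codiag : A.double ⟶ A where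
  fS v := coprod.desc (𝟙 (A.S v)) (𝟙 (A.S v))
  fT e := coprod.desc (𝟙 (A.T e)) (𝟙 (A.T e))
  comm b v h := by
    haveI : PreservesFiniteColimits (𝒢.pull b v h).pullback := (𝒢.pull b v h).property.2
    -- test against the two coprojections of `b^*S_v ⊔ b^*S_v ≅ b^*(S_v ⊔ S_v)`
    apply (cancel_epi (PreservesColimitPair.iso (𝒢.pull b v h).pullback (A.S v) (A.S v)).hom).mp
    apply coprod.hom_ext
    · have h1 : coprod.inl ≫ (PreservesColimitPair.iso (𝒢.pull b v h).pullback (A.S v) (A.S v)).hom =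
          (𝒢.pull b v h).pullback.map coprod.inl := by
        rw [PreservesColimitPair.iso_hom, coprodComparison_inl]
      rw [reassoc_of% h1, reassoc_of% h1, ← Functor.map_comp_assoc, coprod.inl_desc,
        CategoryTheory.Functor.map_id, Category.id_comp, reassoc_of% (A.map_inl_comp_double_ψ_hom b v h),
        coprod.inl_desc, Category.comp_id]
    · have h1 : coprod.inr ≫ (PreservesColimitPair.iso (𝒢.pull b v h).pullback (A.S v) (A.S v)).hom =
          (𝒢.pull b v h).pullback.map coprod.inr := by
        rw [PreservesColimitPair.iso_hom, coprodComparison_inr]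
      rw [reassoc_of% h1, reassoc_of% h1, ← Functor.map_comp_assoc, coprod.inr_desc,
        CategoryTheory.Functor.map_id, Category.id_comp, reassoc_of% (A.map_inr_comp_double_ψ_hom b v h),
        coprod.inr_desc, Category.comp_id]

/-- The first sheet `A → A ⊔ A`. [cite: MochizukiSemiAnbd2006, Def. 2.1 p.23] -/
noncomputable def inl : A ⟶ A.double where
  fS v := (coprod.inl : A.S v ⟶ A.S v ⨿ A.S v)
  fT e := (coprod.inl : A.T e ⟶ A.T e ⨿ A.T e)
  comm b v h := A.map_inl_comp_double_ψ_hom b v h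

/-- The first sheet is a section of the codiagonal. [cite: MochizukiSemiAnbd2006, Def. 2.1 p.23] -/
theorem inl_codiag : A.inl ≫ A.codiag = 𝟙 A := by
  apply BObj.hom_ext
  · funext v
    exact coprod.inl_desc _ _
  · funext e
    exact coprod.inl_desc _ _

variable (b₀ : 𝒢.graph.Branch)
  (Q : {P : Subobject (A.T (𝒢.graph.edgeOf b₀)) //
    PreGaloisCategory.IsConnected (P : 𝒢.E (𝒢.graph.edgeOf b₀))})

open scoped Classical in
/-- The twists of `A ⊔ A` detecting the cell `(e(b₀), Q)`: the component swap over `Q` at `b₀`, the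
identity at every other branch. [cite: MochizukiSemiAnbd2006, Cor. 2.7(i) p.30] -/
noncomputable def doubleTwist (b : 𝒢.graph.Branch) :
    A.double.T (𝒢.graph.edgeOf b) ≅ A.double.T (𝒢.graph.edgeOf b) :=
  if h : b = b₀ then by
    subst h
    exact Anabelioids.componentSwap (A.T (𝒢.graph.edgeOf b)) Q
  else Iso.refl _

/-- At `b₀` the twist is the component swap. [cite: MochizukiSemiAnbd2006, Cor. 2.7(i) p.30] -/
theorem doubleTwist_self :
    A.doubleTwist b₀ Q b₀ = Anabelioids.componentSwap (A.T (𝒢.graph.edgeOf b₀)) Q := by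
  unfold doubleTwist
  rw [dif_pos rfl]

/-- Away from `b₀` the twist is the identity. [cite: MochizukiSemiAnbd2006, Cor. 2.7(i) p.30] -/
theorem doubleTwist_of_ne {b : 𝒢.graph.Branch} (h : b ≠ b₀) : A.doubleTwist b₀ Q b = Iso.refl _ := by
  unfold doubleTwist
  rw [dif_neg h]

/-- The twists lie over `A`. [cite: MochizukiSemiAnbd2006, Cor. 2.7(i) p.30] -/
theorem doubleTwist_codiag (b : 𝒢.graph.Branch) :
    (A.doubleTwist b₀ Q b).hom ≫ A.codiag.fT (𝒢.graph.edgeOf b) = A.codiag.fT (𝒢.graph.edgeOf b) := by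
  by_cases h : b = b₀
  · subst h
    rw [doubleTwist_self]
    exact Anabelioids.componentSwap_hom_comp_desc _ Q
  · rw [A.doubleTwist_of_ne b₀ Q h]
    exact Category.id_comp _

end BObj

/-! ### Sections of the reglued double -/

namespace Hom

variable (φ : Hom 𝒢' 𝒢) {A : 𝒢.BObj} [HasBinaryProducts 𝒢.BObj] (α : Over A ⥤ 𝒢'.BObj)
  [α.IsEquivalence] (eB : φ.pullbackFunctor ≅ Over.star A ⋙ α) (b₀ : 𝒢.graph.Branch)
  (Q : {P : Subobject (A.T (𝒢.graph.edgeOf b₀)) //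
    PreGaloisCategory.IsConnected (P : 𝒢.E (𝒢.graph.edgeOf b₀))})

/-- **If the section avoids the cell `Q`, the reglued double still has a section.**  Let
`φ : 𝒢′ → 𝒢` carry the global clause `(α, e_B)` w.r.t. `A`.  If at every branch `b′` of `𝒢′` over `b₀`
the tautological section `s_{e′}` factors through `φ_{e′}^*(P)` (re-indexed) for a connected component
`P ≠ Q` of `A_{e(φ b′)}` — «`Q` is not the edge section label of any `e′` over `e(b₀)` through `b₀`» —
then the double `A ⊔ A` reglued along the component swap over `Q` at `b₀` admits a morphism from `A`
splitting its codiagonal. [cite: MochizukiSemiAnbd2006, Cor. 2.7(i) p.30] -/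
theorem exists_section_double_reglue
    (havoid : ∀ (b' : 𝒢'.graph.Branch) (v' : 𝒢'.graph.Vertex) (_ : 𝒢'.graph.abuts b' = some v'),
      φ.base.branchMap b' = b₀ →
      ∃ P : {P : Subobject (A.T (𝒢.graph.edgeOf (φ.base.branchMap b'))) //
          PreGaloisCategory.IsConnected (P : 𝒢.E (𝒢.graph.edgeOf (φ.base.branchMap b')))},
        ¬ HEq P Q ∧
          ∃ t : (α.obj (Over.mk (𝟙 A))).T (𝒢'.graph.edgeOf b') ⟶
              (φ.φE (𝒢'.graph.edgeOf b') (𝒢.graph.edgeOf (φ.base.branchMap b'))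
                (φ.base.edgeOf_branchMap b').symm).pullback.obj (P.1 : 𝒢.E _),
            t ≫ (φ.φE (𝒢'.graph.edgeOf b') (𝒢.graph.edgeOf (φ.base.branchMap b'))
                  (φ.base.edgeOf_branchMap b').symm).pullback.map P.1.arrow ≫
                (φ.reindexIso (𝒢'.graph.edgeOf b') _ _ (φ.base.edgeOf_branchMap b').symm rfl).hom.app A =
              (φ.globalSection α eB).fT (𝒢'.graph.edgeOf b')) :
    ∃ σ : A ⟶ A.double.reglue (A.doubleTwist b₀ Q),
      σ ≫ BObj.Hom.reglue A.codiag (A.doubleTwist b₀ Q) (A.doubleTwist_codiag b₀ Q) = 𝟙 A := by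
  -- the engine: the reglued double is isomorphic to the double OVER `A`
  have hsupp : ∀ (b' : 𝒢'.graph.Branch) (v' : 𝒢'.graph.Vertex) (_ : 𝒢'.graph.abuts b' = some v'),
      ∃ (C : 𝒢.E (𝒢.graph.edgeOf (φ.base.branchMap b')))
        (m : C ⟶ A.T (𝒢.graph.edgeOf (φ.base.branchMap b'))),
        pullback.fst (A.codiag.fT (𝒢.graph.edgeOf (φ.base.branchMap b'))) m ≫
              (A.doubleTwist b₀ Q (φ.base.branchMap b')).hom =
            pullback.fst (A.codiag.fT (𝒢.graph.edgeOf (φ.base.branchMap b'))) m ∧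
          ∃ t : (α.obj (Over.mk (𝟙 A))).T (𝒢'.graph.edgeOf b') ⟶
              (φ.φE (𝒢'.graph.edgeOf b') (𝒢.graph.edgeOf (φ.base.branchMap b'))
                (φ.base.edgeOf_branchMap b').symm).pullback.obj C,
            t ≫ (φ.φE (𝒢'.graph.edgeOf b') (𝒢.graph.edgeOf (φ.base.branchMap b'))
                  (φ.base.edgeOf_branchMap b').symm).pullback.map m ≫
                (φ.reindexIso (𝒢'.graph.edgeOf b') _ _ (φ.base.edgeOf_branchMap b').symm rfl).hom.app A =
              (φ.globalSection α eB).fT (𝒢'.graph.edgeOf b') := by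
    intro b' v' h'
    by_cases hb : φ.base.branchMap b' = b₀
    · obtain ⟨P, hPQ, t, ht⟩ := havoid b' v' h' hb
      refine ⟨(P.1 : 𝒢.E _), P.1.arrow, ?_, t, ht⟩
      subst hb
      rw [BObj.doubleTwist_self]
      exact Anabelioids.fst_comp_componentSwap_of_ne _ Q P (fun h => hPQ (heq_of_eq h))
    · refine ⟨A.T _, 𝟙 _, ?_, (φ.globalSection α eB).fT (𝒢'.graph.edgeOf b') ≫
        (φ.reindexIso (𝒢'.graph.edgeOf b') _ _ (φ.base.edgeOf_branchMap b').symm rfl).inv.app A, ?_⟩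
      · rw [A.doubleTwist_of_ne b₀ Q hb]
        exact Category.comp_id _
      · rw [CategoryTheory.Functor.map_id, Category.id_comp, Category.assoc, Iso.inv_hom_id_app]
        exact Category.comp_id _
  let ι := φ.overIsoOfSupportedReglue α eB A.codiag (A.doubleTwist b₀ Q) (A.doubleTwist_codiag b₀ Q)
    hsupp
  refine ⟨A.inl ≫ ι.hom.left, ?_⟩
  have hw : ι.hom.left ≫ BObj.Hom.reglue A.codiag (A.doubleTwist b₀ Q) (A.doubleTwist_codiag b₀ Q) =
      A.codiag := Over.w ι.hom
  rw [Category.assoc, hw]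
  exact A.inl_codiag

end Hom

end SemiGraphOfAnabelioids

end SemiGraphs

end Literature.AnabelianGeometry
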